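/- Copyright: the b2b-balaban cell (near-miss cell 7), T⁴-continuum fan-out, NE7b swarm leaf 04 (gen 6; road W-RP, sub-row
«W3j»: the tower-ready inductive step of the (RP-ext) chain and its level-0 instance over the Gibbs state).  Released
under the licence of the surrounding project. -/
import Summits.QuantumFields.BalabanUV.T4Continuum.Support.HistoryRPTwoLevel
import Summits.QuantumFields.BalabanUV.T4Continuum.Support.HistoryRPGibbs

/-!
# History chessboard road: the TOWER-READY inductive step and the level-0 instance (W3j)

Summits-side support leaf of the T⁴-continuum cell (rung (B)+1 on a FINITE torus only; NOT infinite volume, NOT the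
mass gap, NOT the Clay statement; NOT a proof of the spine estimate NE7b).  Road W-RP (R-OWNER-23-2 ∕ R-OWNER-23-8) of
the swarm claim table `t4/b2b-balaban-t4-ne7b-p1/LEAVES-NE7b.md`, sub-row «W3j» (journal INTENT of leaf-04 g6; owner
l.15147 «iterate over levels only if cheap»), on top of W3i (`HistoryRPTwoLevel`) and W3h (`HistoryRPGibbs`, leaf-06 g5).
[folklore] packaging; no `structure`, no `[cite:]` tag, no `Prop`-valued definition (c1: `towerStep` is DATA), no constant
(c2∕c6), no exit ∕ socket ∕ `HistoryConstants` file (c3); nothing printed asserted.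

WHAT.
* §1 **THE INDUCTIVE STEP over an arbitrary base** `(Ω, mQ, Θ, ν)` that carries the current fine field of level `j`
  through a measurable projection `π : Ω → GaugeField P j G` reading positive data positively
  (`Measurable[mQ, mPos G j ρ] π`) and intertwining the reflections (`π ∘ Θ = c_ρ ∘ π`): `towerStep ρ π q :=
  (q.1.1, glue ρ (q.1.2, q.2))` (W3i's `glue`), `towerStep_semiconj`, `measurable_towerStep_pos`, the state identity
  `map_towerStep` (`= ν.map (ω ↦ (ω, av.avg (π ω)))`), and **`rpPackage_towerStep`**: RP-package of `(ν, mQ, Θ)` in ⇒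
  RP-package of `(ν.map (ω ↦ (ω, av.avg (π ω))), mQ.prod (mPos G (j+1) ρ), Prod.map Θ (c_ρ))` out, for any
  measurable `av : Setup.Averaging` with `TwoBlockLocal av` + centre-reflection equivariance; `rpPackage_towerStep_blockAvg`
  for Bałaban's (0.4).  (W3i's `rpPackage_twoLevel` is the case `Ω := GaugeField P j G`, `π := id`; the `K`-fold law
  `(U, Ū, Ū², …)` iterates with `Ω := Ω_k`, `π :=` the last coordinate.)
* §2 **THE LEVEL-0 INSTANCE FROM W3h BY NAME**: `rpPackage_twoLevel_gibbs` ∕ `rpPackage_twoLevel_gibbs_SU` — the joint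
  law of the cell's level-0 Gibbs (Wilson) state `T4GenFunBounds.gibbsMeasure P β` and its block average (0.4) carries
  the five-member RP-package for `(mPos G 0 ρ).prod (mPos G 1 ρ)` and `c_ρ × c_ρ` (W3i ∘ W3h's
  `rpPackage_gibbs_creflect(_SU)`); hypothesis-free for `SU(n)` up to `0 ≤ β`, `1 ≤ m + K`, measurable `E`.
* §3 **THE FIRST ITERATE**: `rpPackage_threeLevel_gibbs_SU` — the law of `((U₀, Ū), Ū²)` under the `SU(n)` Gibbs state
  (§1 at `Ω := GaugeField P 0 G × GaugeField P 1 G`, `π := Prod.snd`, on top of §2), `2 ≤ m + K`.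

HONEST SCOPE.  Packaging∕iteration bookkeeping over W3f∕W3i∕W3h and the tree's `blockAvg_creflect` ∕
`twoBlockLocal_blockAvg`; centre cut only (other cuts: W3g); (EXT)∕(LOC)-for-events, (R-sym), (U1)∕(G2) and the
identification of W4b′'s per-cutoff carrier with the tower law stay displayed; the typing identification «`blockAvg ℰ`
is Bałaban's (0.4)» is T-class as everywhere in the cell.  NE7b NOT proved; spine 0∕9.  HONEST DEPENDENCY (cell):
continuum YM on T⁴ ⇐ BetaPertH ∧ nine spine estimates (0/9 proved); BetaPertH ⇐ (D1) ∧ (D4) ∧ CAP+tail; G-an2-4 gates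
asym, D1 and NE2/3/4.  This file changes none of it. -/

open MeasureTheory ProbabilityTheory
open Literature.MathematicalPhysics.QuantumFieldTheory
open Literature.MathematicalPhysics.QuantumFieldTheory.Balaban1983to89
open Literature.MathematicalPhysics.QuantumFieldTheory.LatticeRP (IsReflectionPositiveBdd)
open BlockAveraging T4ReflectionConeSharp
open Summit.QuantumFields.BalabanUV.T4Continuum.HistoryRPHalfTorus
open Summit.QuantumFields.BalabanUV.T4Continuum.HistoryRPAveraging
open Summit.QuantumFields.BalabanUV.T4Continuum.HistoryRPTwoLevel

namespace Summit.QuantumFields.BalabanUV.T4Continuum.HistoryRPTower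

noncomputable section

/-! ## §1 The inductive step over an arbitrary base -/

section Step

variable {P : Params} {j : ℕ} {G : Type*} [GaugeGroup G] {Ω : Type*} {mQ : MeasurableSpace Ω}
  (ρ : Fin P.d) (π : Ω → GaugeField P j G)

/-- **`towerStep`**: W3b's carrier over the base `Ω` read in plain coordinates `(base point, new coarse field)`. -/
def towerStep (q : (Ω × ((↥(posBonds P (j + 1) ρ) → G) × (↥(posBonds P (j + 1) ρ) → G))) ×
    (↥(crossBonds P (j + 1) ρ) → G)) : Ω × GaugeField P (j + 1) G :=
  (q.1.1, glue ρ (q.1.2, q.2))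

/-- `towerStep` is measurable. [folklore] -/
theorem measurable_towerStep [MeasurableSpace Ω] [MeasurableSpace G] [MeasurableInv G] :
    Measurable (towerStep (P := P) (j := j) (G := G) ρ (Ω := Ω)) :=
  (measurable_fst.comp measurable_fst).prodMk
    ((measurable_glue ρ).comp ((measurable_snd.comp measurable_fst).prodMk measurable_snd))

/-- `towerStep` intertwines W3d's reflection `((Θ ω, swap), τ z)` with `Prod.map Θ c_ρ` (`creflect_glue`). [folklore] -/
theorem towerStep_semiconj (Θ : Ω → Ω)
    (q : (Ω × ((↥(posBonds P (j + 1) ρ) → G) × (↥(posBonds P (j + 1) ρ) → G))) × (↥(crossBonds P (j + 1) ρ) → G)) :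
    towerStep ρ (Ω := Ω) ((Θ q.1.1, q.1.2.swap), crossRefl ρ q.2) =
      Prod.map Θ (GaugeField.creflect ρ) (towerStep ρ q) := by
  simp only [towerStep, Prod.map_apply, creflect_glue]

/-- `towerStep` reads positive data positively: W3d's positive σ-algebra over `(mQ, y₊)` ↦ `mQ.prod (mPos G (j+1) ρ)`.
[folklore] -/
theorem measurable_towerStep_pos [MeasurableSpace G] :
    @Measurable _ _
      (((mQ.prod (inferInstance : MeasurableSpace (↥(posBonds P (j + 1) ρ) → G))).comap
          (fun p : Ω × ((↥(posBonds P (j + 1) ρ) → G) × (↥(posBonds P (j + 1) ρ) → G)) => (p.1, p.2.1))).comap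
        Prod.fst)
      (mQ.prod (mPos G (j + 1) ρ)) (towerStep (P := P) (j := j) (G := G) ρ (Ω := Ω)) := by
  have hΦ₀ : @Measurable _ _
      (((mQ.prod (inferInstance : MeasurableSpace (↥(posBonds P (j + 1) ρ) → G))).comap
          (fun p : Ω × ((↥(posBonds P (j + 1) ρ) → G) × (↥(posBonds P (j + 1) ρ) → G)) => (p.1, p.2.1))).comap
        Prod.fst)
      (mQ.prod (inferInstance : MeasurableSpace (↥(posBonds P (j + 1) ρ) → G)))
      (fun q : (Ω × ((↥(posBonds P (j + 1) ρ) → G) × (↥(posBonds P (j + 1) ρ) → G))) ×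
        (↥(crossBonds P (j + 1) ρ) → G) => (q.1.1, q.1.2.1)) := by
    rw [MeasurableSpace.comap_comp]
    exact comap_measurable _
  have h1 := (@measurable_fst _ _ mQ (inferInstance : MeasurableSpace (↥(posBonds P (j + 1) ρ) → G))).comp hΦ₀
  have h2 := (@measurable_snd _ _ mQ (inferInstance : MeasurableSpace (↥(posBonds P (j + 1) ρ) → G))).comp hΦ₀
  refine @Measurable.prodMk _ _ _ _ mQ (mPos G (j + 1) ρ) _ _ h1 ?_
  refine measurable_comap_iff.2 (@measurable_pi_lambda _ _ _ (_) _ _ fun c => ?_)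
  have hc : (c : PBond P (j + 1)) ∈ posBonds P (j + 1) ρ := Finset.mem_coe.1 c.2
  show @Measurable _ _ (_) _ fun q : (Ω × ((↥(posBonds P (j + 1) ρ) → G) × (↥(posBonds P (j + 1) ρ) → G))) ×
      (↥(crossBonds P (j + 1) ρ) → G) => glue ρ (q.1.2, q.2) (c : PBond P (j + 1))
  have key : (fun q : (Ω × ((↥(posBonds P (j + 1) ρ) → G) × (↥(posBonds P (j + 1) ρ) → G))) ×
      (↥(crossBonds P (j + 1) ρ) → G) => glue ρ (q.1.2, q.2) (c : PBond P (j + 1))) = fun q => q.1.2.1 ⟨c, hc⟩ :=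
    funext fun q => glue_of_mem_posBonds ρ _ hc
  rw [key]
  exact (measurable_pi_apply _).comp h2

variable (av : Averaging P j G)

/-- **THE STATE IDENTITY over the base `Ω`**: W3d's δ-extended state built from the read-outs of `π ω`, read through
`towerStep`, IS `ν.map (ω ↦ (ω, av.avg (π ω)))`. [folklore] -/
theorem map_towerStep [MeasurableSpace Ω] [MeasurableSpace G] [MeasurableInv G] (hA : Measurable av.avg) (hπ : Measurable π)
    {Θ : Ω → Ω} (hΘm : Measurable Θ) (hπΘ : ∀ ω, π (Θ ω) = (π ω).creflect ρ)
    (hR : ∀ U : GaugeField P j G, av.avg (U.creflect ρ) = (av.avg U).creflect ρ) (ν : Measure Ω) [SFinite ν] :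
    ((ν ⊗ₘ ((Kernel.deterministic (posRead ρ av ∘ π) ((measurable_posRead ρ av hA).comp hπ)) ×ₖ
        (Kernel.deterministic (posRead ρ av ∘ π) ((measurable_posRead ρ av hA).comp hπ)).comap Θ hΘm)) ⊗ₘ
      Kernel.deterministic (fun p : Ω × ((↥(posBonds P (j + 1) ρ) → G) × (↥(posBonds P (j + 1) ρ) → G)) =>
        crossRead ρ av (π p.1, p.2)) ((measurable_crossRead ρ av hA).comp (hπ.prodMap measurable_id))).map
      (towerStep ρ) = ν.map fun ω => (ω, av.avg (π ω)) := by
  have hf := (measurable_posRead ρ av hA).comp hπ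
  have hg : Measurable fun p : Ω × ((↥(posBonds P (j + 1) ρ) → G) × (↥(posBonds P (j + 1) ρ) → G)) =>
      crossRead ρ av (π p.1, p.2) := (measurable_crossRead ρ av hA).comp (hπ.prodMap measurable_id)
  have hm1 : Measurable fun a : Ω => (a, ((posRead ρ av ∘ π) a, (posRead ρ av ∘ π) (Θ a))) :=
    measurable_id.prodMk (hf.prodMk (hf.comp hΘm))
  have hm2 : Measurable fun a : Ω × ((↥(posBonds P (j + 1) ρ) → G) × (↥(posBonds P (j + 1) ρ) → G)) =>
      (a, crossRead ρ av (π a.1, a.2)) := measurable_id.prodMk hg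
  rw [HistoryRPDeterministic.pairKernel_deterministic hΘm hf, Measure.compProd_deterministic,
    Measure.compProd_deterministic]
  show Measure.map (towerStep ρ) (Measure.map (fun a : Ω × ((↥(posBonds P (j + 1) ρ) → G) ×
      (↥(posBonds P (j + 1) ρ) → G)) => (a, crossRead ρ av (π a.1, a.2)))
      (Measure.map (fun a : Ω => (a, ((posRead ρ av ∘ π) a, (posRead ρ av ∘ π) (Θ a)))) ν)) =
    Measure.map (fun ω => (ω, av.avg (π ω))) ν
  rw [Measure.map_map hm2 hm1, Measure.map_map (measurable_towerStep ρ) (hm2.comp hm1)]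
  congr 1
  funext ω
  simp only [Function.comp_apply, towerStep, hπΘ, glue_reads av hR]

/-- **THE TOWER-READY INDUCTIVE STEP** (abstract averaging): from an RP-package of the base `(ν, mQ, Θ)` on `Ω` and a
current-field projection `π` (measurable, positive-reading, intertwining), the law `ν.map (ω ↦ (ω, av.avg (π ω)))` on
`Ω × GaugeField P (j+1) G` carries the five-member RP-package for `mQ.prod (mPos G (j+1) ρ)` and `Prod.map Θ c_ρ`,
for any measurable `av` with `TwoBlockLocal av` and centre-reflection equivariance. [folklore] -/
theorem rpPackage_towerStep [MeasurableSpace Ω] [MeasurableSpace G] [MeasurableInv G] (hj : j + 1 ≤ P.m + P.K)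
    {av : Averaging P j G} (hA : Measurable av.avg) (hL : TwoBlockLocal av)
    (hR : ∀ U : GaugeField P j G, av.avg (U.creflect ρ) = (av.avg U).creflect ρ)
    (hπ : Measurable π) (hπQ : @Measurable _ _ mQ (mPos G j ρ) π)
    {Θ : Ω → Ω} (hπΘ : ∀ ω, π (Θ ω) = (π ω).creflect ρ) {ν : Measure Ω} [IsFiniteMeasure ν]
    (hmQ : mQ ≤ (inferInstance : MeasurableSpace Ω)) (hΘm : Measurable Θ) (hΘ : MeasurePreserving Θ ν ν)
    (hΘΘ : Θ ∘ Θ = id) (hRP : IsReflectionPositiveBdd ν mQ Θ) :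
    mQ.prod (mPos G (j + 1) ρ) ≤ (inferInstance : MeasurableSpace (Ω × GaugeField P (j + 1) G)) ∧
      Measurable (Prod.map Θ (GaugeField.creflect ρ) : Ω × GaugeField P (j + 1) G → Ω × GaugeField P (j + 1) G) ∧
      MeasurePreserving (Prod.map Θ (GaugeField.creflect ρ))
        (ν.map fun ω => (ω, av.avg (π ω))) (ν.map fun ω => (ω, av.avg (π ω))) ∧
      ((Prod.map Θ (GaugeField.creflect ρ) : Ω × GaugeField P (j + 1) G → Ω × GaugeField P (j + 1) G) ∘
        Prod.map Θ (GaugeField.creflect ρ) = id) ∧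
      IsReflectionPositiveBdd (ν.map fun ω => (ω, av.avg (π ω))) (mQ.prod (mPos G (j + 1) ρ))
        (Prod.map Θ (GaugeField.creflect ρ)) := by
  have hΘ' : Measurable (Prod.map Θ (GaugeField.creflect ρ) :
      Ω × GaugeField P (j + 1) G → Ω × GaugeField P (j + 1) G) := hΘm.prodMap (measurable_creflect ρ)
  have hle : mQ.prod (mPos G (j + 1) ρ) ≤ (inferInstance : MeasurableSpace (Ω × GaugeField P (j + 1) G)) :=
    prod_le_prod hmQ (mPos_le G (j + 1) ρ)
  have hι : Measurable fun ω : Ω => (ω, av.avg (π ω)) := measurable_id.prodMk (hA.comp hπ)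
  -- W3d's one-level package over the base, with (i) and (iii) discharged through `π`
  have hf := (measurable_posRead ρ av hA).comp hπ
  have hfP : @Measurable _ _ mQ _ (posRead ρ av ∘ π) := (measurable_posRead_mPos ρ av hj hA hL).comp hπQ
  have hg : Measurable fun p : Ω × ((↥(posBonds P (j + 1) ρ) → G) × (↥(posBonds P (j + 1) ρ) → G)) =>
      crossRead ρ av (π p.1, p.2) := (measurable_crossRead ρ av hA).comp (hπ.prodMap measurable_id)
  have hsemi : ∀ p : Ω × ((↥(posBonds P (j + 1) ρ) → G) × (↥(posBonds P (j + 1) ρ) → G)),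
      crossRead ρ av (π (Θ p.1), p.2.swap) = crossRefl ρ (crossRead ρ av (π p.1, p.2)) := fun p => by
    rw [hπΘ]; exact crossRead_semiconj ρ av hR (π p.1, p.2)
  have h5 := (HistoryRPDeterministic.rpPackage_level_deterministic hmQ hΘm hΘ hΘΘ hRP hf hfP hg
    (measurable_crossRefl ρ) (crossRefl_comp_self ρ) hsemi).2.2.2.2
  refine ⟨hle, hΘ', ?_, ?_, ?_⟩
  · exact measurePreserving_map_of_semiconj hΘ hΘ' hι fun ω => by
      simp only [Prod.map_apply, hπΘ, hR]
  · funext p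
    obtain ⟨ω, V⟩ := p
    show (Θ (Θ ω), GaugeField.creflect ρ (GaugeField.creflect ρ V)) = (ω, V)
    rw [creflect_creflect, show Θ (Θ ω) = ω from congrFun hΘΘ ω]
  · rw [← map_towerStep ρ π av hA hπ hΘm hπΘ hR ν]
    exact isReflectionPositiveBdd_map hle hΘ' (measurable_towerStep ρ) (measurable_towerStep_pos ρ)
      (towerStep_semiconj ρ Θ) h5

/-- **THE INDUCTIVE STEP FOR BAŁABAN'S BLOCK AVERAGING (0.4)** (tree `blockAvg ℰ`; (LOC) by `twoBlockLocal_blockAvg`,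
(γ) by `blockAvg_creflect`). [folklore] -/
theorem rpPackage_towerStep_blockAvg [MeasurableSpace Ω] [MeasurableSpace G] [RegularGaugeGroup G] (hj : j + 1 ≤ P.m + P.K)
    (ℰ : LoopAverage G) (hE : ∀ n, Measurable fun W : Fin (n + 1) → G => ℰ.E W)
    (hπ : Measurable π) (hπQ : @Measurable _ _ mQ (mPos G j ρ) π)
    {Θ : Ω → Ω} (hπΘ : ∀ ω, π (Θ ω) = (π ω).creflect ρ) {ν : Measure Ω} [IsFiniteMeasure ν]
    (hmQ : mQ ≤ (inferInstance : MeasurableSpace Ω)) (hΘm : Measurable Θ) (hΘ : MeasurePreserving Θ ν ν)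
    (hΘΘ : Θ ∘ Θ = id) (hRP : IsReflectionPositiveBdd ν mQ Θ) :
    mQ.prod (mPos G (j + 1) ρ) ≤ (inferInstance : MeasurableSpace (Ω × GaugeField P (j + 1) G)) ∧
      Measurable (Prod.map Θ (GaugeField.creflect ρ) : Ω × GaugeField P (j + 1) G → Ω × GaugeField P (j + 1) G) ∧
      MeasurePreserving (Prod.map Θ (GaugeField.creflect ρ))
        (ν.map fun ω => (ω, (blockAvg (P := P) (j := j) ℰ).avg (π ω)))
        (ν.map fun ω => (ω, (blockAvg (P := P) (j := j) ℰ).avg (π ω))) ∧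
      ((Prod.map Θ (GaugeField.creflect ρ) : Ω × GaugeField P (j + 1) G → Ω × GaugeField P (j + 1) G) ∘
        Prod.map Θ (GaugeField.creflect ρ) = id) ∧
      IsReflectionPositiveBdd (ν.map fun ω => (ω, (blockAvg (P := P) (j := j) ℰ).avg (π ω)))
        (mQ.prod (mPos G (j + 1) ρ)) (Prod.map Θ (GaugeField.creflect ρ)) :=
  rpPackage_towerStep ρ π hj (measurable_avgFun ℰ hE) (twoBlockLocal_blockAvg ℰ) (blockAvg_creflect ℰ ρ) hπ hπQ hπΘ
    hmQ hΘm hΘ hΘΘ hRP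

end Step

/-! ## §2 The level-0 instance over the Gibbs (Wilson) state, from W3h by name -/

section Gibbs

variable {P : Params} {G : Type*} [GaugeGroup G] [MeasurableSpace G] [RegularGaugeGroup G] [HaarData G]
  [TopologicalSpace G] [IsTopologicalGroup G] [CompactSpace G] [BorelSpace G] {N : ℕ}
  (ϱ : G →* Matrix (Fin N) (Fin N) ℂ)

/-- **THE JOINT LAW OF THE LEVEL-0 GIBBS STATE AND ITS BLOCK AVERAGE (0.4) IS REFLECTION POSITIVE AT EVERY CENTRE
CUT** (general compact `G` under W3h's dictionary hypotheses): W3i's `rpPackage_twoLevel_blockAvg` at `j = 0` with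
both base binders supplied by W3h's `rpPackage_gibbs_creflect`. [folklore] -/
theorem rpPackage_twoLevel_gibbs (hhaar : (HaarData.haar : Measure G) = haarProbability G) (hϱ : Continuous ϱ)
    (hN : N ≠ 0) (hre : ∀ g : G, reTr g * N = ((ϱ g).trace).re) {β : ℝ} (hβ : 0 ≤ β) (hK : 0 + 1 ≤ P.m + P.K)
    (ρ : Fin P.d) (ℰ : LoopAverage G) (hE : ∀ n, Measurable fun W : Fin (n + 1) → G => ℰ.E W) :
    (mPos G 0 ρ).prod (mPos G (0 + 1) ρ) ≤
        (inferInstance : MeasurableSpace (GaugeField P 0 G × GaugeField P (0 + 1) G)) ∧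
      Measurable (Prod.map (GaugeField.creflect ρ) (GaugeField.creflect ρ) :
        GaugeField P 0 G × GaugeField P (0 + 1) G → GaugeField P 0 G × GaugeField P (0 + 1) G) ∧
      MeasurePreserving (Prod.map (GaugeField.creflect ρ) (GaugeField.creflect ρ))
        ((T4GenFunBounds.gibbsMeasure (G := G) P β).map fun U => (U, (blockAvg (P := P) (j := 0) ℰ).avg U))
        ((T4GenFunBounds.gibbsMeasure (G := G) P β).map fun U => (U, (blockAvg (P := P) (j := 0) ℰ).avg U)) ∧
      ((Prod.map (GaugeField.creflect ρ) (GaugeField.creflect ρ) :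
          GaugeField P 0 G × GaugeField P (0 + 1) G → GaugeField P 0 G × GaugeField P (0 + 1) G) ∘
        Prod.map (GaugeField.creflect ρ) (GaugeField.creflect ρ) = id) ∧
      IsReflectionPositiveBdd
        ((T4GenFunBounds.gibbsMeasure (G := G) P β).map fun U => (U, (blockAvg (P := P) (j := 0) ℰ).avg U))
        ((mPos G 0 ρ).prod (mPos G (0 + 1) ρ)) (Prod.map (GaugeField.creflect ρ) (GaugeField.creflect ρ)) := by
  haveI := T4GenFunBounds.isProbabilityMeasure_gibbsMeasure (G := G) P hβ
  obtain ⟨-, -, hθ, -, hRP⟩ := HistoryRPGibbs.rpPackage_gibbs_creflect (P := P) ϱ hhaar hϱ hN hre hβ ρ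
  exact rpPackage_twoLevel_blockAvg hK ρ ℰ hE hθ hRP

/-- **… HYPOTHESIS-FREE FOR `SU(n)`** (up to `0 ≤ β`, `1 ≤ m + K`, measurable small-loop `E`): the joint law of the
`SU(n)` Wilson–Gibbs state on Bałaban's finest torus and its block average (0.4) is reflection positive at every centre
cut, for the positive fine + coarse bonds (W3h's `rpPackage_gibbs_creflect_SU`). [folklore] -/
theorem rpPackage_twoLevel_gibbs_SU {n : ℕ} [NeZero n] (P : Params) {β : ℝ} (hβ : 0 ≤ β) (hK : 0 + 1 ≤ P.m + P.K)
    (ρ : Fin P.d) (ℰ : LoopAverage (Matrix.specialUnitaryGroup (Fin n) ℂ))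
    (hE : ∀ k, Measurable fun W : Fin (k + 1) → Matrix.specialUnitaryGroup (Fin n) ℂ => ℰ.E W) :
    (mPos (Matrix.specialUnitaryGroup (Fin n) ℂ) 0 ρ).prod (mPos (Matrix.specialUnitaryGroup (Fin n) ℂ) (0 + 1) ρ) ≤
        (inferInstance : MeasurableSpace (GaugeField P 0 (Matrix.specialUnitaryGroup (Fin n) ℂ) ×
          GaugeField P (0 + 1) (Matrix.specialUnitaryGroup (Fin n) ℂ))) ∧
      Measurable (Prod.map (GaugeField.creflect ρ) (GaugeField.creflect ρ) :
        GaugeField P 0 (Matrix.specialUnitaryGroup (Fin n) ℂ) × GaugeField P (0 + 1) (Matrix.specialUnitaryGroup (Fin n) ℂ) →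
          GaugeField P 0 (Matrix.specialUnitaryGroup (Fin n) ℂ) ×
            GaugeField P (0 + 1) (Matrix.specialUnitaryGroup (Fin n) ℂ)) ∧
      MeasurePreserving (Prod.map (GaugeField.creflect ρ) (GaugeField.creflect ρ))
        ((T4GenFunBounds.gibbsMeasure (G := Matrix.specialUnitaryGroup (Fin n) ℂ) P β).map fun U =>
          (U, (blockAvg (P := P) (j := 0) ℰ).avg U))
        ((T4GenFunBounds.gibbsMeasure (G := Matrix.specialUnitaryGroup (Fin n) ℂ) P β).map fun U =>
          (U, (blockAvg (P := P) (j := 0) ℰ).avg U)) ∧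
      ((Prod.map (GaugeField.creflect ρ) (GaugeField.creflect ρ) :
          GaugeField P 0 (Matrix.specialUnitaryGroup (Fin n) ℂ) ×
              GaugeField P (0 + 1) (Matrix.specialUnitaryGroup (Fin n) ℂ) →
            GaugeField P 0 (Matrix.specialUnitaryGroup (Fin n) ℂ) ×
              GaugeField P (0 + 1) (Matrix.specialUnitaryGroup (Fin n) ℂ)) ∘
        Prod.map (GaugeField.creflect ρ) (GaugeField.creflect ρ) = id) ∧
      IsReflectionPositiveBdd
        ((T4GenFunBounds.gibbsMeasure (G := Matrix.specialUnitaryGroup (Fin n) ℂ) P β).map fun U =>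
          (U, (blockAvg (P := P) (j := 0) ℰ).avg U))
        ((mPos (Matrix.specialUnitaryGroup (Fin n) ℂ) 0 ρ).prod (mPos (Matrix.specialUnitaryGroup (Fin n) ℂ) (0 + 1) ρ))
        (Prod.map (GaugeField.creflect ρ) (GaugeField.creflect ρ)) := by
  haveI := T4GenFunBounds.isProbabilityMeasure_gibbsMeasure (G := Matrix.specialUnitaryGroup (Fin n) ℂ) P hβ
  obtain ⟨-, -, hθ, -, hRP⟩ := HistoryRPGibbs.rpPackage_gibbs_creflect_SU (n := n) P hβ ρ
  exact rpPackage_twoLevel_blockAvg hK ρ ℰ hE hθ hRP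

end Gibbs

/-! ## §3 The first iterate: the three-level law `((U₀, Ū), Ū²)` -/

section ThreeLevel

variable {n : ℕ} [NeZero n]

/-- **THE THREE-LEVEL LAW OF THE `SU(n)` GIBBS STATE IS REFLECTION POSITIVE AT EVERY CENTRE CUT** (the first iterate:
§1 at `Ω := GaugeField P 0 G × GaugeField P 1 G`, `π := Prod.snd`, on top of §2; `2 ≤ m + K`; both steps Bałaban's
(0.4) with small-loop averages `ℰ₀`, `ℰ₁`). [folklore] -/
theorem rpPackage_threeLevel_gibbs_SU (P : Params) {β : ℝ} (hβ : 0 ≤ β) (hK : (0 + 1) + 1 ≤ P.m + P.K)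
    (ρ : Fin P.d) (ℰ₀ ℰ₁ : LoopAverage (Matrix.specialUnitaryGroup (Fin n) ℂ))
    (hE₀ : ∀ k, Measurable fun W : Fin (k + 1) → Matrix.specialUnitaryGroup (Fin n) ℂ => ℰ₀.E W)
    (hE₁ : ∀ k, Measurable fun W : Fin (k + 1) → Matrix.specialUnitaryGroup (Fin n) ℂ => ℰ₁.E W) :
    IsReflectionPositiveBdd
      (((T4GenFunBounds.gibbsMeasure (G := Matrix.specialUnitaryGroup (Fin n) ℂ) P β).map fun U =>
          (U, (blockAvg (P := P) (j := 0) ℰ₀).avg U)).map fun ω => (ω, (blockAvg (P := P) (j := 0 + 1) ℰ₁).avg ω.2))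
      (((mPos (Matrix.specialUnitaryGroup (Fin n) ℂ) 0 ρ).prod (mPos (Matrix.specialUnitaryGroup (Fin n) ℂ) (0 + 1) ρ)).prod
        (mPos (Matrix.specialUnitaryGroup (Fin n) ℂ) (0 + 1 + 1) ρ))
      (Prod.map (Prod.map (GaugeField.creflect ρ) (GaugeField.creflect ρ)) (GaugeField.creflect ρ)) := by
  haveI := T4GenFunBounds.isProbabilityMeasure_gibbsMeasure (G := Matrix.specialUnitaryGroup (Fin n) ℂ) P hβ
  obtain ⟨hle, hΘm, hΘ, hΘΘ, hRP⟩ := rpPackage_twoLevel_gibbs_SU (n := n) P hβ (by omega) ρ ℰ₀ hE₀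
  exact (rpPackage_towerStep_blockAvg (mQ := (mPos (Matrix.specialUnitaryGroup (Fin n) ℂ) 0 ρ).prod
      (mPos (Matrix.specialUnitaryGroup (Fin n) ℂ) (0 + 1) ρ)) ρ Prod.snd hK ℰ₁ hE₁ measurable_snd
    (@measurable_snd _ _ (mPos _ 0 ρ) (mPos _ (0 + 1) ρ)) (fun _ => rfl) hle hΘm hΘ hΘΘ hRP).2.2.2.2

end ThreeLevel

end

end Summit.QuantumFields.BalabanUV.T4Continuum.HistoryRPTower
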